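import Literature.Geometry.Riemannian.SphericalCylinderEntropyZonalSmooth
import Literature.Geometry.Riemannian.SphericalCylinderEntropy
import Mathlib.MeasureTheory.Integral.Lebesgue.DominatedConvergence
import HarnessLib

/-!
# Continuity in the scale of the typed slice-normalised density `τ ↦ F̂_{p,τ}(A)`

Registered helper `helper_continuousAt_cylDensity` (H2 of the lead's "unit lower density along
cylinder flows" chain; line `killing-flux`, crux `CylinderEntropy.CylinderRungTwo`,
stmt-SmoothPoincare4-7631).

For a compact `A ⊆ N = S⁴ × ℝ ⊂ ℝ⁶` of finite `μH⁴`-measure, a centre `p ∈ ℝ⁶` and a scale `σ > 0`,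
the typed density `τ ↦ cylDensity A p τ = vol(S⁴)⁻¹ ∫_A K_{p,τ} dμH⁴` is continuous at `τ = σ`:
dominated convergence for `∫⁻` over the finite measure `μH⁴⌊A` (filter `𝓝 σ`), the typed kernel
`(τ, z) ↦ K_{p,τ}(z)` being jointly continuous on `(0, ∞) × ℝ⁶`
(`Literature…SphericalCylinderEntropy.contDiffOn_cylKernel_prod`), hence bounded on the compact
`[σ/2, 2σ] × A`, and continuous in `τ` at `σ` for every fixed `z` (`contDiffAt_cylKernel_tau`); the
non-degenerate constant `vol(S⁴)⁻¹ ≠ ⊤` factors out (`inv_hausdorffMeasure_sphere_four_ne_zero_ne_top`).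

## References
* R. S. Hamilton, *Monotonicity formulas for parabolic flows on manifolds*, Comm. Anal. Geom. 1
  (1993), 127–137 (the density).
-/

noncomputable section

open MeasureTheory Set Filter
open scoped ContDiff ENNReal NNReal Topology BigOperators

set_option linter.dupNamespace false

namespace Summit.SmoothPoincare4.SmoothPoincare4.Cruxes.CylinderRungTwo.KillingFlux

open Literature.Geometry.Riemannian
open Literature.Geometry.Riemannian.SphericalCylinderEntropy (cylEntropy cylDensity cylKernel truncL
  contDiffOn_cylKernel_prod contDiff_cylKernel contDiffAt_cylKernel_tau
  inv_hausdorffMeasure_sphere_four_ne_zero_ne_top)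

/-- **Dominated convergence for the kernel integral.**  For a compact `A ⊆ ℝ⁶` with `μH⁴(A) < ⊤`, every
centre `p` and every `σ > 0`, `τ ↦ ∫_A K_{p,τ} dμH⁴` (as a `lintegral` of `ENNReal.ofReal ∘ K_{p,τ}`
over `μH⁴⌊A`) tends to `∫_A K_{p,σ} dμH⁴` as `τ → σ`: the jointly continuous kernel is bounded on the
compact `[σ/2, 2σ] × A` (the dominating constant is integrable for the finite measure `μH⁴⌊A`) and
`τ ↦ K_{p,τ}(z)` is continuous at `σ` for each `z`. [folklore] -/
theorem tendsto_setLIntegral_cylKernel {A : Set (EuclideanSpace ℝ (Fin 6))} (hA : IsCompact A)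
    (hAfin : μH[4] A < ⊤) (p : EuclideanSpace ℝ (Fin 6)) {σ : ℝ} (hσ : 0 < σ) :
    Tendsto (fun τ : ℝ => ∫⁻ z in A, ENNReal.ofReal (cylKernel p τ z) ∂μH[4]) (𝓝 σ)
      (𝓝 (∫⁻ z in A, ENNReal.ofReal (cylKernel p σ z) ∂μH[4])) := by
  -- a uniform bound of the jointly continuous kernel on the compact `[σ/2, 2σ] × A`
  have hK : IsCompact (Icc (σ / 2) (2 * σ) ×ˢ A) := isCompact_Icc.prod hA
  have hsub : Icc (σ / 2) (2 * σ) ×ˢ A ⊆ Ioi (0 : ℝ) ×ˢ (univ : Set (EuclideanSpace ℝ (Fin 6))) :=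
    prod_mono (fun τ hτ => lt_of_lt_of_le (half_pos hσ) hτ.1) (subset_univ _)
  have hcont : ContinuousOn (fun q : ℝ × EuclideanSpace ℝ (Fin 6) => cylKernel p q.1 q.2)
      (Icc (σ / 2) (2 * σ) ×ˢ A) :=
    (contDiffOn_cylKernel_prod p).continuousOn.mono hsub
  obtain ⟨B, hB⟩ := hK.exists_bound_of_continuousOn hcont
  refine tendsto_lintegral_filter_of_dominated_convergence (μ := μH[4].restrict A) (l := 𝓝 σ)
    (F := fun τ z => ENNReal.ofReal (cylKernel p τ z)) (f := fun z => ENNReal.ofReal (cylKernel p σ z))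
    (fun _ => ENNReal.ofReal B) ?_ ?_ ?_ ?_
  · -- measurability of the slices `z ↦ K_{p,τ}(z)` for `τ > 0`
    filter_upwards [lt_mem_nhds hσ] with τ hτ
    exact (contDiff_cylKernel p hτ).continuous.measurable.ennreal_ofReal
  · -- domination by the constant `B` for `τ ∈ [σ/2, 2σ]` and `z ∈ A`
    filter_upwards [Icc_mem_nhds (half_lt_self hσ) (by linarith : σ < 2 * σ)] with τ hτ
    filter_upwards [ae_restrict_mem hA.isClosed.measurableSet] with z hz
    refine ENNReal.ofReal_le_ofReal ((le_abs_self _).trans ?_)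
    have h := hB (τ, z) ⟨hτ, hz⟩
    rwa [Real.norm_eq_abs] at h
  · -- the constant is integrable for the finite measure `μH⁴⌊A`
    rw [setLIntegral_const]
    exact ENNReal.mul_ne_top ENNReal.ofReal_ne_top hAfin.ne
  · -- pointwise continuity in `τ` at `σ`
    refine ae_of_all _ fun z => ?_
    exact ENNReal.tendsto_ofReal ((contDiffAt_cylKernel_tau p z hσ).continuousAt.tendsto)

/-- **Continuity in the scale of the typed density** (registered helper H2 of line `killing-flux`).
For a compact `A ⊆ N = {z ∈ ℝ⁶ | ∑_{i<5} zᵢ² = 1}` with `μH⁴(A) < ⊤`, every centre `p ∈ ℝ⁶` and every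
`σ > 0`, the typed slice-normalised density `τ ↦ cylDensity A p τ = vol(S⁴)⁻¹ ∫_A K_{p,τ} dμH⁴` is
continuous at `σ`: the constant `vol(S⁴)⁻¹ ≠ ⊤` factors out of the limit
(`ENNReal.Tendsto.const_mul`) and the kernel integral is continuous in `τ` by dominated convergence
(`tendsto_setLIntegral_cylKernel`). [folklore] -/
theorem helper_continuousAt_cylDensity : ∀ A : Set (EuclideanSpace ℝ (Fin 6)), IsCompact A → (∀ z ∈ A, ∑ i : Fin 5, z (Fin.castSucc i) ^ 2 = 1) → μH[4] A < ⊤ → ∀ (p : EuclideanSpace ℝ (Fin 6)) (σ : ℝ), 0 < σ → ContinuousAt (fun τ : ℝ => cylDensity A p τ) σ := by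
  intro A hA _ hAfin p σ hσ
  rw [ContinuousAt]
  simp only [cylDensity]
  exact ENNReal.Tendsto.const_mul (tendsto_setLIntegral_cylKernel hA hAfin p hσ)
    (Or.inr inv_hausdorffMeasure_sphere_four_ne_zero_ne_top.2)

end Summit.SmoothPoincare4.SmoothPoincare4.Cruxes.CylinderRungTwo.KillingFlux

end
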